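import Summits.ABC.IUTFork.Repair.RHWithinPlaceFinancingHeightLaw
import HarnessLib

/-!
# R-H ROUND 3, AXIS D2 — class «WITHIN-PLACE FINANCING»: the ALL-HEIGHTS CAP (barrier shape)

PROOF-ONLY companion (0 definitions, 0 `Prop` facts, no instance, no notation) of `RHWithinPlaceFinancingHeightLaw` (abc-iut-rh2-q2-cond g11,
KEY D2-EXP-3; D-0127/D-0130 axis D2). That file proves the ASYMPTOTIC law of the class (above the financing-collapse height the recovered mass
`min(C_σ, R)` is trapped in the `m`-free bracket `[δ + 2G, δ + 2G + (e−1)]`: exponent `−1` exactly). This file adds what a BARRIER statement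
(21-frontier AXIS D (a): «every combination of objects of classes X has exponent < 0») needs from this class: a cap valid at EVERY height.
CURRENCY as there (spelled out, no `def`): exact U2 cell `RH.DiffPricedHull.HullCellδ e m j δ r_in r_out`, `G := r_in − r_out`, slack
`s_j := price_j − d_j = jδ + (j+1)G + ρ_j − (j²−1)m`, labels `j = 1 + k`, `k < J`; the on-slice credit is `C_σ = Σ_{j ≤ j₀} s_j` and the class
recovers `min(C_σ, R) ≤ C_σ` at the place.
WHAT IS PROVED (namespace `Summit.ABC.IUTFork.Repair.RH.WithinPlaceFinancingHeightLaw`, continued):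
* `sum_slack_le_of_label` — at a holding label `J`: `Σ_{j ≤ J} s_j ≤ J·(Jδ + (J+1)G + (e−1))` (`0 ≤ m`);
* `sum_slack_le_capPi` (+ closed form `two_mul_capPi_eq`) — **at every height `m ≥ 0`, for every `J ≤ L` (no cell hypothesis)**:
  `Σ_{j ≤ J} s_j ≤ C_Π := Σ_{j ≤ L} (jδ + (j+1)G + (e−1))` (RULING R82 (b)'s ∀-constant, per place; `2·C_Π = δL(L+1) + G·L(L+3) + 2L(e−1)`);
* `two_mul_sum_slack_le_cap` — the same in abc-iut-rh2-T-1's «capSum» currency: `2·Σ_{j ≤ J} s_j ≤ (δ + 2G + (e−1))·L(L+1)`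
  (recovered mass ≤ (δ+2G+e−1)·l⋆(l⋆+1)/2 at ALL heights);
* `sum_slack_le_heightFree` — **at every height `m ≥ 1`**, `l⋆`-free: `Σ_{j ≤ J} s_j ≤ (1+B)·((1+B)δ + (2+B)G + (e−1))`, `B := δ + G + (e−1)`, for every
  holding label `J ≥ 1` (so for `J = j₀`: `C_σ ≤` a HEIGHT-FREE constant of the place) — by the j₀ law `sliceBoundary_sub_one_mul_le` of the law
  file; hence the class's recovered fraction is `≤ const/(m·S(l⋆))` at ALL heights (exponent `≤ −1` globally, `= −1` above the onset);
* `row_frey7_l107_capPi` / `row_frey7_l107_heightFree_cap` — the caps at the D-0121 worked place X1 (C_Π `9,414,496` = the audited «envelope» of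
  rh2-w-2's barrier p531802; capSum `18,156,528`; `l⋆`-free `400,906,225,200`) against the bed credit `C_σ = 1,138,639` and the asymptotic ceiling `12,688`.
HONEST FRAMING: integer inequalities about OUR typed cell; nothing here asserts that abc is proved or refuted, that [IUTchIII] Cor. 3.12 holds
or fails at any datum, or takes a side on any author; typed ≠ proved; computed ≠ proved.
[cite: Mochizuki2012, IUTchIV Prop. 1.2 (i)(ii) p. 10, Prop. 1.4 p. 13; IUTchIII Cor. 3.12 p. 173–174] [claim: Mochizuki2012, status: disputed]
-/

namespace Summit.ABC.IUTFork.Repair.RH.WithinPlaceFinancingHeightLaw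

open Finset
open Summit.ABC.IUTFork.Repair.RH.DiffPricedHull Summit.ABC.IUTFork.Repair.RH.HullCellSlice
open Summit.ABC.IUTFork.Repair.RH.HullCellSlackSum

/-! ## All heights: the class never recovers more than a height-free constant (barrier shape) -/

/-- **On-slice credit bound at a holding label.** If the cell holds at `J ≥ 1` (so at every `j ≤ J`, downward closure) then
`Σ_{j ≤ J} s_j ≤ J·(J·δ + (J+1)·G + (e−1))` (`0 < e`, `0 ≤ δ`, `r_out ≤ r_in`, `0 ≤ m`): each slack is at most its price
(`d_j = (j²−1)m ≥ 0`), each price at most `jδ + (j+1)G + (e−1) ≤ Jδ + (J+1)G + (e−1)`. In particular the on-slice credit `C_σ`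
(`J = j₀`) obeys it. [folklore] -/
theorem sum_slack_le_of_label {e m δ rin rout : ℤ} (he : 0 < e) (hδ : 0 ≤ δ) (hio : rout ≤ rin) (hm : 0 ≤ m) (J : ℕ) :
    ∑ k ∈ range J, (((1 + (k : ℤ)) * δ + (1 + (k : ℤ) + 1) * (rin - rout) +
        ((1 + (k : ℤ)) ^ 2 * m - (1 + (k : ℤ)) * δ - (1 + (k : ℤ) + 1) * rin) % e) - ((1 + (k : ℤ)) ^ 2 - 1) * m)
      ≤ (J : ℤ) * ((J : ℤ) * δ + ((J : ℤ) + 1) * (rin - rout) + (e - 1)) := by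
  have hG : 0 ≤ rin - rout := by linarith
  have hterm : ∀ k ∈ range J, (((1 + (k : ℤ)) * δ + (1 + (k : ℤ) + 1) * (rin - rout) +
        ((1 + (k : ℤ)) ^ 2 * m - (1 + (k : ℤ)) * δ - (1 + (k : ℤ) + 1) * rin) % e) - ((1 + (k : ℤ)) ^ 2 - 1) * m)
      ≤ (J : ℤ) * δ + ((J : ℤ) + 1) * (rin - rout) + (e - 1) := by
    intro k hk
    have hkJ : (k : ℤ) + 1 ≤ (J : ℤ) := by exact_mod_cast mem_range.1 hk
    have hk0 : (0 : ℤ) ≤ (k : ℤ) := Int.natCast_nonneg k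
    obtain ⟨h0, h1⟩ := gain_bounds he m (1 + (k : ℤ)) δ rin
    have hd : 0 ≤ ((1 + (k : ℤ)) ^ 2 - 1) * m := mul_nonneg (by nlinarith) hm
    nlinarith
  calc ∑ k ∈ range J, (((1 + (k : ℤ)) * δ + (1 + (k : ℤ) + 1) * (rin - rout) +
        ((1 + (k : ℤ)) ^ 2 * m - (1 + (k : ℤ)) * δ - (1 + (k : ℤ) + 1) * rin) % e) - ((1 + (k : ℤ)) ^ 2 - 1) * m)
      ≤ ∑ _k ∈ range J, ((J : ℤ) * δ + ((J : ℤ) + 1) * (rin - rout) + (e - 1)) := sum_le_sum hterm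
    _ = (J : ℤ) * ((J : ℤ) * δ + ((J : ℤ) + 1) * (rin - rout) + (e - 1)) := by
      rw [sum_const, card_range, nsmul_eq_mul]

/-- **ALL-HEIGHTS CAP, `l⋆`-aware (the ∀-constant «C_Π» of D2-REFUTE-2's guard, here as a theorem).** At EVERY height `m ≥ 0`
(`0 < e`, `0 ≤ δ`, `r_out ≤ r_in`) and for EVERY `J ≤ L` (read `J = j₀ ≤ l⋆ = L`; NO cell hypothesis needed):
`2·Σ_{j ≤ J} s_j ≤ (δ + 2G + (e−1))·L·(L+1)` — each slack is at most its price (`d_j ≥ 0`), the prices of the labels `1..J` sum to at most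
`(δ+2G+e−1)·J(J+1)/2` (`HullCellSlackSum.two_mul_sum_price_le` at `J = 0`), monotone in `J ≤ L`. So the on-slice credit, hence the class's
recovered mass `min(C_σ, R) ≤ C_σ`, is `≤ (δ+2G+e−1)·l⋆(l⋆+1)/2` at ALL heights: with the place mass `m·S(l⋆)` the recovered fraction is
`≤ const/h` for every `s ≥ 1` (the asymptotic constant of §4 is `δ + 2G + (e−1)`, smaller by the factor `l⋆(l⋆+1)/2`). [folklore] -/
theorem two_mul_sum_slack_le_cap {e m δ rin rout : ℤ} (he : 0 < e) (hδ : 0 ≤ δ) (hio : rout ≤ rin) (hm : 0 ≤ m) {J L : ℕ} (hJL : J ≤ L) :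
    2 * ∑ k ∈ range J, (((1 + (k : ℤ)) * δ + (1 + (k : ℤ) + 1) * (rin - rout) +
        ((1 + (k : ℤ)) ^ 2 * m - (1 + (k : ℤ)) * δ - (1 + (k : ℤ) + 1) * rin) % e) - ((1 + (k : ℤ)) ^ 2 - 1) * m)
      ≤ (δ + 2 * (rin - rout) + (e - 1)) * ((L : ℤ) * ((L : ℤ) + 1)) := by
  have hG : 0 ≤ rin - rout := by linarith
  -- slack ≤ price termwise (demand ≥ 0)
  have h1 : ∑ k ∈ range J, (((1 + (k : ℤ)) * δ + (1 + (k : ℤ) + 1) * (rin - rout) +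
        ((1 + (k : ℤ)) ^ 2 * m - (1 + (k : ℤ)) * δ - (1 + (k : ℤ) + 1) * rin) % e) - ((1 + (k : ℤ)) ^ 2 - 1) * m)
      ≤ ∑ k ∈ range J, ((1 + (k : ℤ)) * δ + (1 + (k : ℤ) + 1) * (rin - rout) +
        ((1 + (k : ℤ)) ^ 2 * m - (1 + (k : ℤ)) * δ - (1 + (k : ℤ) + 1) * rin) % e) := by
    apply sum_le_sum
    intro k _
    have hk0 : (0 : ℤ) ≤ (k : ℤ) := Int.natCast_nonneg k
    have hd : 0 ≤ ((1 + (k : ℤ)) ^ 2 - 1) * m := mul_nonneg (by nlinarith) hm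
    linarith
  -- prices of labels 1..J: `two_mul_sum_price_le` at `J = 0`
  have h2 := two_mul_sum_price_le (m := m) (δ := δ) (rin := rin) (rout := rout) (J := 0) he hio le_rfl J
  simp only [zero_add, mul_zero] at h2
  -- monotone in J ≤ L
  have hc : 0 ≤ δ + 2 * (rin - rout) + (e - 1) := by linarith
  have hJL' : (J : ℤ) ≤ (L : ℤ) := by exact_mod_cast hJL
  have hJ0 : (0 : ℤ) ≤ (J : ℤ) := Int.natCast_nonneg J
  have h3 : (δ + 2 * (rin - rout) + (e - 1)) * ((J : ℤ) * ((J : ℤ) + 1)) ≤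
      (δ + 2 * (rin - rout) + (e - 1)) * ((L : ℤ) * ((L : ℤ) + 1)) :=
    mul_le_mul_of_nonneg_left (by nlinarith) hc
  linarith

/-- **ALL-HEIGHTS CAP in the desk's currency «C_Π» (RULING R82 (b); D2-REFUTE-2 12:46:34Z).** At EVERY height `m ≥ 0` (`0 < e`,
`0 ≤ δ`, `r_out ≤ r_in`) and for EVERY `J ≤ L` (read `J = j₀ ≤ l⋆ = L`; no cell hypothesis):
`Σ_{j ≤ J} s_j ≤ Σ_{j ≤ L} (jδ + (j+1)G + (e−1))` =: `C_Π(place)` — slack ≤ price ≤ its residue-free bound termwise (`d_j ≥ 0`, `ρ_j ≤ e−1`),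
and the bound's terms are non-negative so the sum only grows from `J` to `L`. At the worked place X1 this is `9,414,496` (`row_frey7_l107_capPi`;
= the «envelope» of abc-iut-rh2-w-2's barrier file p531802 as audited). [folklore] -/
theorem sum_slack_le_capPi {e m δ rin rout : ℤ} (he : 0 < e) (hδ : 0 ≤ δ) (hio : rout ≤ rin) (hm : 0 ≤ m) {J L : ℕ} (hJL : J ≤ L) :
    ∑ k ∈ range J, (((1 + (k : ℤ)) * δ + (1 + (k : ℤ) + 1) * (rin - rout) +
        ((1 + (k : ℤ)) ^ 2 * m - (1 + (k : ℤ)) * δ - (1 + (k : ℤ) + 1) * rin) % e) - ((1 + (k : ℤ)) ^ 2 - 1) * m)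
      ≤ ∑ k ∈ range L, ((1 + (k : ℤ)) * δ + (1 + (k : ℤ) + 1) * (rin - rout) + (e - 1)) := by
  have hG : 0 ≤ rin - rout := by linarith
  have h1 : ∑ k ∈ range J, (((1 + (k : ℤ)) * δ + (1 + (k : ℤ) + 1) * (rin - rout) +
        ((1 + (k : ℤ)) ^ 2 * m - (1 + (k : ℤ)) * δ - (1 + (k : ℤ) + 1) * rin) % e) - ((1 + (k : ℤ)) ^ 2 - 1) * m)
      ≤ ∑ k ∈ range J, ((1 + (k : ℤ)) * δ + (1 + (k : ℤ) + 1) * (rin - rout) + (e - 1)) := by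
    apply sum_le_sum
    intro k _
    have hk0 : (0 : ℤ) ≤ (k : ℤ) := Int.natCast_nonneg k
    have hd : 0 ≤ ((1 + (k : ℤ)) ^ 2 - 1) * m := mul_nonneg (by nlinarith) hm
    have hρ := (gain_bounds he m (1 + (k : ℤ)) δ rin).2
    linarith
  have h2 : ∑ k ∈ range J, ((1 + (k : ℤ)) * δ + (1 + (k : ℤ) + 1) * (rin - rout) + (e - 1))
      ≤ ∑ k ∈ range L, ((1 + (k : ℤ)) * δ + (1 + (k : ℤ) + 1) * (rin - rout) + (e - 1)) := by
    apply sum_le_sum_of_subset_of_nonneg (range_mono hJL)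
    intro k _ _
    have hk0 : (0 : ℤ) ≤ (k : ℤ) := Int.natCast_nonneg k
    nlinarith
  exact le_trans h1 h2

/-- Closed form of the cap: `2·C_Π = δ·L(L+1) + G·L(L+3) + 2L(e−1)`. [folklore] -/
theorem two_mul_capPi_eq (e δ rin rout : ℤ) (L : ℕ) :
    2 * ∑ k ∈ range L, ((1 + (k : ℤ)) * δ + (1 + (k : ℤ) + 1) * (rin - rout) + (e - 1))
      = δ * ((L : ℤ) * ((L : ℤ) + 1)) + (rin - rout) * ((L : ℤ) * ((L : ℤ) + 3)) + 2 * (L : ℤ) * (e - 1) := by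
  induction L with
  | zero => simp
  | succ L ih =>
    rw [sum_range_succ, mul_add, ih]
    push_cast
    ring

/-- **ALL-HEIGHTS CAP (barrier shape for axis D2).** At EVERY height `m ≥ 1` (`0 < e`, `0 ≤ δ`, `r_out ≤ r_in`): if the cell holds at the
label `J ≥ 1` then, with `B := δ + G + (e−1)`, `Σ_{j ≤ J} s_j ≤ (1 + B)·((1 + B)·δ + (2 + B)·G + (e−1))` — a HEIGHT-FREE constant of the
place (`J ≤ 1 + B` by `sliceBoundary_sub_one_mul_le` and `m ≥ 1`, then `sum_slack_le_of_label`). Since the class recovers `min(C_σ, R) ≤ C_σ`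
(the case `J = j₀`), within-place financing NEVER recovers more than this constant while the place mass `m·S(l⋆)` grows linearly in the height:
recovered fraction `≤ const/h` at all heights (exponent `≤ −1` globally, `= −1` above the onset by §4). Crude in `B` (the asymptotic constant is
`δ + 2G + (e−1)`, §4) but height-free, which is what a barrier statement needs. [folklore] -/
theorem sum_slack_le_heightFree {e m δ rin rout : ℤ} (he : 0 < e) (hδ : 0 ≤ δ) (hio : rout ≤ rin) (hm : 1 ≤ m) {J : ℕ} (hJ : 1 ≤ J)
    (hcell : HullCellδ e m (J : ℤ) δ rin rout) :
    ∑ k ∈ range J, (((1 + (k : ℤ)) * δ + (1 + (k : ℤ) + 1) * (rin - rout) +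
        ((1 + (k : ℤ)) ^ 2 * m - (1 + (k : ℤ)) * δ - (1 + (k : ℤ) + 1) * rin) % e) - ((1 + (k : ℤ)) ^ 2 - 1) * m)
      ≤ (1 + (δ + (rin - rout) + (e - 1))) *
          ((1 + (δ + (rin - rout) + (e - 1))) * δ + (2 + (δ + (rin - rout) + (e - 1))) * (rin - rout) + (e - 1)) := by
  have hG : 0 ≤ rin - rout := by linarith
  have hB : 0 ≤ δ + (rin - rout) + (e - 1) := by linarith
  have hJ1 : (1 : ℤ) ≤ (J : ℤ) := by exact_mod_cast hJ
  have hJB0 := sliceBoundary_sub_one_mul_le he hδ hio hJ1 hcell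
  have hJB : (J : ℤ) ≤ 1 + (δ + (rin - rout) + (e - 1)) := by nlinarith
  have h1 := sum_slack_le_of_label he hδ hio (by linarith) J (m := m) (rin := rin) (rout := rout)
  have h2 : (J : ℤ) * ((J : ℤ) * δ + ((J : ℤ) + 1) * (rin - rout) + (e - 1)) ≤
      (1 + (δ + (rin - rout) + (e - 1))) *
        ((1 + (δ + (rin - rout) + (e - 1))) * δ + (2 + (δ + (rin - rout) + (e - 1))) * (rin - rout) + (e - 1)) := by
    have hJ0 : (0 : ℤ) ≤ (J : ℤ) := by linarith
    have hin : (J : ℤ) * δ + ((J : ℤ) + 1) * (rin - rout) + (e - 1) ≤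
        (1 + (δ + (rin - rout) + (e - 1))) * δ + (2 + (δ + (rin - rout) + (e - 1))) * (rin - rout) + (e - 1) := by nlinarith
    have hin0 : 0 ≤ (J : ℤ) * δ + ((J : ℤ) + 1) * (rin - rout) + (e - 1) := by nlinarith
    calc (J : ℤ) * ((J : ℤ) * δ + ((J : ℤ) + 1) * (rin - rout) + (e - 1))
        ≤ (J : ℤ) * ((1 + (δ + (rin - rout) + (e - 1))) * δ + (2 + (δ + (rin - rout) + (e - 1))) * (rin - rout) + (e - 1)) :=
          mul_le_mul_of_nonneg_left hin hJ0
      _ ≤ (1 + (δ + (rin - rout) + (e - 1))) *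
          ((1 + (δ + (rin - rout) + (e - 1))) * δ + (2 + (δ + (rin - rout) + (e - 1))) * (rin - rout) + (e - 1)) :=
          mul_le_mul_of_nonneg_right hJB (by linarith)
  exact le_trans h1 h2

/-- The `l⋆`-aware caps at the worked place X1 (`l⋆ = 53`): `(δ + 2G + e − 1)·l⋆(l⋆+1)/2 = 12688·1431 = 18,156,528` (abc-iut-rh2-T-1's «capSum»)
and `C_Π = (δ·53·54 + G·53·56 + 2·53·(e−1))/2 = 9,414,496` (the desk's C_Π; = the audited «envelope» of p531802) — 16× / 8.3× the bed credit
`C_σ = 1,138,639`, `1431×` / `742×` the asymptotic ceiling `12,688`; height-free. [folklore] -/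
theorem row_frey7_l107_capPi :
    ((1604 : ℤ) + 2 * (268 - (-4472)) + (1605 - 1)) * (53 * (53 + 1)) = 2 * 18156528 ∧ (1138639 : ℤ) ≤ 18156528 ∧
      (1604 : ℤ) * (53 * (53 + 1)) + (268 - (-4472)) * (53 * (53 + 3)) + 2 * 53 * (1605 - 1) = 2 * 9414496 ∧
      (1138639 : ℤ) ≤ 9414496 := by
  norm_num

/-- Bed witness for the all-heights cap at the worked place X1 (`δ = 1604`, `G = 4740`, `e = 1605`: `B = 7948`,
cap `= 7949·(7949·1604 + 7950·4740 + 1604) = 400,906,225,200`) against the exact on-slice credit at the bed `C_σ = 1,138,639`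
(p488873 §6 / FINAL (1)(b)) and the asymptotic bracket `[11084, 12688]`: crude by five orders at the bed, exact in shape (height-free). [folklore] -/

theorem row_frey7_l107_heightFree_cap :
    (1 + ((1604 : ℤ) + (268 - (-4472)) + (1605 - 1))) *
        ((1 + ((1604 : ℤ) + (268 - (-4472)) + (1605 - 1))) * 1604 + (2 + ((1604 : ℤ) + (268 - (-4472)) + (1605 - 1))) * (268 - (-4472)) +
          (1605 - 1)) = 400906225200 ∧ (1138639 : ℤ) ≤ 400906225200 := by
  norm_num

end Summit.ABC.IUTFork.Repair.RH.WithinPlaceFinancingHeightLaw
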